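import Summits.AtomisticToContinuum.BoseEinsteinCondensation.Theses.BECSwapNoCatastrophe
import Summits.AtomisticToContinuum.BoseEinsteinCondensation.Theorems.BECSwapNoCatastropheMidpointLemmaTwoCopy
import Literature.MathematicalPhysics.QuantumManyBody.MeanSelfDensity
import Literature.MathematicalPhysics.QuantumManyBody.PeriodicBoseGasThm31
import HarnessLib

/-!
# Route BECSwapNoCatastrophe — `MidpointLemma` (item stmt-AtomisticToContinuum-14396)

Closes the support item
`Summit.AtomisticToContinuum.BoseEinsteinCondensation.Theses.BECSwapNoCatastrophe.MidpointLemma`,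
i.e. `TorusHalfSwapOverlap → TorusSwapBound`.

Fix `v`, take `ρ₀` from `TorusHalfSwapOverlap`, and for `0 < ρ < ρ₀` its `η > 0`; put `c := 2η`.
For `n` in the eventual set take its `δ > 0`. Given a periodic `δ`-near-minimiser `Ψ` of the
one-copy energy:

1. the admissible class `Adm` of the two-copy form `E2` contains the normalised constant
   (`exists_adm_const`, the two-copy cell has finite positive volume), so it contains a
   `δ`-near-minimiser `Θ` of `E2` (`exists_le_iInf₂_add`: either `inf = ⊤` and any member works,
   or `inf < inf + δ`);
2. `TorusHalfSwapOverlap` gives `|⟨Θ, Ψ ⊗ Ψ⟩_{C₂}|² ≥ ½ + η`;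
3. `Θ` is measurable, swap-symmetric and normalised on `C₂ = cell^{n+1} × cell^{n+1}`, so the
   midpoint inequality `two_mul_sq_sub_one_le_swapPurity_indicator` (`⟨Φ, UΦ⟩ ≥ 2|⟨Θ, Φ⟩|² - 1`
   in `L²(C₂)` for `Φ = 1_{C₂} Ψ ⊗ Ψ`, `U = (· ∘ F)`, together with the swap identity
   `⟨Φ, UΦ⟩ = tr(γ_Ψ²)/N²` of `BECSwapNoCatastropheMidpointLemmaTwoCopy.lean`) yields
   `swapPurity n (1_{cell^{n+1}} Ψ) ≥ 2(½ + η) - 1 = 2η = c`.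

* `two_mul_sq_sub_one_le_swapPurity` — the midpoint inequality combined with the swap identity in
  `L²` of the glue coordinates `q = ((X̂, Ŷ), (x, y))` (`e q = (x :: X̂, y :: Ŷ)`, swap
  `Prod.map id Prod.swap`): for `‖Ψ‖₂ = 1` and a unit, swap-symmetric `Θ`,
  `2 |∫ conj Θ · (Ψ ⊗ Ψ)|² - 1 ≤ swapPurity n Ψ`.
* `two_mul_sq_sub_one_le_swapPurity_indicator` — the same transported to the two-copy cell
  `cell^{n+1} × cell^{n+1}` of the torus (truncations by indicators).
* `exists_adm_const` — the normalised constant is admissible for the two-copy problem.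
* `ofReal_two_mul_le_swapPurity` — steps 1–3 for one `Ψ`, abstract in `Adm`/`E2`.
* `midpointLemma_proof` — the item.
-/

noncomputable section

-- The Lebesgue `MeasureSpace` instance of the glue coordinates
-- `((ℝ³)ⁿ × (ℝ³)ⁿ) × (ℝ³ × ℝ³)` is found by the default search but its term exceeds the default
-- `synthInstance.maxSize` (four copies of the `EuclideanSpace` instance); raise the bound.
set_option synthInstance.maxSize 512

open MeasureTheory Filter
open scoped ENNReal NNReal ComplexConjugate InnerProductSpace

namespace Summit.AtomisticToContinuum.BoseEinsteinCondensation.Theorems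

open Literature.MathematicalPhysics.QuantumManyBody.BoseGas

section Midpoint

variable {n : ℕ}

/-- **The midpoint inequality for the one-pair swap**, in glue coordinates. Let
`Ψ : (ℝ³)^{n+1} → ℂ` be measurable with `∫ |Ψ|² = 1` and let `Θ` be a unit vector of `L²` of the
glue coordinates which is symmetric under the swap `(x, y) ↦ (y, x)`. Then
`2 |∫ conj Θ · Ψ(x::X̂) Ψ(y::Ŷ)|² - 1 ≤ swapPurity n Ψ`.
Proof: in `L²`, `θ = Θ`, `φ = Ψ ⊗ Ψ`, `ψ = φ ∘ F` satisfy `‖θ‖ = ‖φ‖ = ‖ψ‖ = 1` and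
`⟨θ, ψ⟩ = ⟨θ, φ⟩` (change of variables under the measure-preserving involution `F` and
`Θ ∘ F = Θ`), so `two_mul_norm_inner_sq_sub_le_re_inner` gives
`2|⟨θ, φ⟩|² - 1 ≤ Re⟨ψ, φ⟩ = swapPurity n Ψ` (`integral_twoCopy_swap_eq_swapPurity`).
[cite: PenroseOnsager1956, §4 (5)–(6)] -/
theorem two_mul_sq_sub_one_le_swapPurity {Ψ : Config (n + 1) → ℂ} (hΨ : Measurable Ψ)
    (hΨ1 : ∫⁻ Z, (‖Ψ Z‖₊ : ℝ≥0∞) ^ 2 = 1)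
    {Θ : (Config n × Config n) × (Space × Space) → ℂ} (hΘ : Measurable Θ)
    (hΘ1 : ∫⁻ q, (‖Θ q‖₊ : ℝ≥0∞) ^ 2 = 1)
    (hΘF : ∀ q, Θ (Prod.map id Prod.swap q) = Θ q) :
    2 * ‖∫ q : (Config n × Config n) × (Space × Space),
        conj (Θ q) * (Ψ (Matrix.vecCons q.2.1 q.1.1) * Ψ (Matrix.vecCons q.2.2 q.1.2))‖ ^ 2 - 1 ≤
      (swapPurity n Ψ).toReal := by
  -- the product state `Φ = Ψ ⊗ Ψ` and the swap `F` in glue coordinates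
  set Φ : (Config n × Config n) × (Space × Space) → ℂ := fun q =>
    Ψ (Matrix.vecCons q.2.1 q.1.1) * Ψ (Matrix.vecCons q.2.2 q.1.2) with hΦ_def
  set F : (Config n × Config n) × (Space × Space) → (Config n × Config n) × (Space × Space) :=
    Prod.map id Prod.swap with hF_def
  have hF : MeasurePreserving F volume volume :=
    (MeasurePreserving.id (volume : Measure (Config n × Config n))).prod
      (Measure.measurePreserving_swap (μ := (volume : Measure Space))
        (ν := (volume : Measure Space)))
  let Fe : (Config n × Config n) × (Space × Space) ≃ᵐ (Config n × Config n) × (Space × Space) :=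
    MeasurableEquiv.prodCongr (MeasurableEquiv.refl _) MeasurableEquiv.prodComm
  have hFe : MeasurePreserving Fe volume volume := hF
  have hFe_apply : ∀ q, Fe q = F q := fun q => rfl
  have hFF : ∀ q, F (F q) = q := by
    rintro ⟨⟨X, Y⟩, ⟨x, y⟩⟩
    rfl
  have hΦF : ∀ q : (Config n × Config n) × (Space × Space), Φ (F q) =
      Ψ (Matrix.vecCons q.2.2 q.1.1) * Ψ (Matrix.vecCons q.2.1 q.1.2) := by
    rintro ⟨⟨X, Y⟩, ⟨x, y⟩⟩
    rfl
  -- `L²` memberships and norms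
  have hΦm : Measurable Φ :=
    (hΨ.comp twoCopy_measurable_vecCons.1).mul (hΨ.comp twoCopy_measurable_vecCons.2)
  have hΦ1 : ∫⁻ q, (‖Φ q‖₊ : ℝ≥0∞) ^ 2 = 1 := by
    rw [hΦ_def, lintegral_twoCopy_prod hΨ, hΨ1, one_pow]
  have hΦmem : MemLp Φ 2 volume :=
    ⟨hΦm.aestronglyMeasurable, by rw [eLpNorm_two_eq_one_of_lintegral hΦ1]; exact ENNReal.one_lt_top⟩
  have hΘmem : MemLp Θ 2 volume :=
    ⟨hΘ.aestronglyMeasurable, by rw [eLpNorm_two_eq_one_of_lintegral hΘ1]; exact ENNReal.one_lt_top⟩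
  have hΦFmem : MemLp (Φ ∘ F) 2 volume := hΦmem.comp_measurePreserving hF
  -- the three vectors
  set θ : Lp ℂ 2 (volume : Measure ((Config n × Config n) × (Space × Space))) := hΘmem.toLp Θ
    with hθ_def
  set φ : Lp ℂ 2 (volume : Measure ((Config n × Config n) × (Space × Space))) := hΦmem.toLp Φ
    with hφ_def
  set ψ : Lp ℂ 2 (volume : Measure ((Config n × Config n) × (Space × Space))) :=
    hΦFmem.toLp (Φ ∘ F) with hψ_def
  have hθ1 : ‖θ‖ = 1 := by
    rw [hθ_def, Lp.norm_toLp, eLpNorm_two_eq_one_of_lintegral hΘ1, ENNReal.toReal_one]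
  have hφ1 : ‖φ‖ = 1 := by
    rw [hφ_def, Lp.norm_toLp, eLpNorm_two_eq_one_of_lintegral hΦ1, ENNReal.toReal_one]
  have hψφ : ‖ψ‖ = ‖φ‖ := by
    rw [hψ_def, hφ_def, Lp.norm_toLp, Lp.norm_toLp,
      eLpNorm_comp_measurePreserving hΦm.aestronglyMeasurable hF]
  -- a.e. representatives
  have hae_θ : (θ : (Config n × Config n) × (Space × Space) → ℂ) =ᵐ[volume] Θ :=
    hΘmem.coeFn_toLp
  have hae_φ : (φ : (Config n × Config n) × (Space × Space) → ℂ) =ᵐ[volume] Φ :=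
    hΦmem.coeFn_toLp
  have hae_ψ : (ψ : (Config n × Config n) × (Space × Space) → ℂ) =ᵐ[volume] Φ ∘ F :=
    hΦFmem.coeFn_toLp
  -- inner products as integrals
  have hinner_θφ : ⟪θ, φ⟫_ℂ = ∫ q, conj (Θ q) * Φ q := by
    rw [L2.inner_def]
    refine integral_congr_ae ?_
    filter_upwards [hae_θ, hae_φ] with q h1 h2
    rw [RCLike.inner_apply', h1, h2]
  have hinner_θψ : ⟪θ, ψ⟫_ℂ = ∫ q, conj (Θ q) * Φ (F q) := by
    rw [L2.inner_def]
    refine integral_congr_ae ?_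
    filter_upwards [hae_θ, hae_ψ] with q h1 h2
    rw [RCLike.inner_apply', h1, h2]
    rfl
  have hinner_ψφ : ⟪ψ, φ⟫_ℂ = ∫ q, conj (Φ (F q)) * Φ q := by
    rw [L2.inner_def]
    refine integral_congr_ae ?_
    filter_upwards [hae_ψ, hae_φ] with q h1 h2
    rw [RCLike.inner_apply', h1, h2]
    rfl
  -- `⟨θ, ψ⟩ = ⟨θ, φ⟩`: change of variables `q ↦ F q` and the swap symmetry of `Θ`
  have hsym : ⟪θ, ψ⟫_ℂ = ⟪θ, φ⟫_ℂ := by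
    rw [hinner_θψ, hinner_θφ, ← hFe.integral_comp' (fun q => conj (Θ q) * Φ (F q))]
    refine integral_congr_ae (Filter.Eventually.of_forall fun q => ?_)
    simp only [hFe_apply]
    rw [hΘF, hFF]
  -- the abstract midpoint inequality
  have hH := two_mul_norm_inner_sq_sub_le_re_inner θ φ ψ hθ1 hψφ hsym
  rw [hφ1, one_pow, hinner_θφ, hinner_ψφ] at hH
  -- the swap identity evaluates the right-hand side
  have hint : Integrable (fun q => conj (Φ (F q)) * Φ q) volume := by
    refine (L2.integrable_inner (𝕜 := ℂ) ψ φ).congr ?_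
    filter_upwards [hae_ψ, hae_φ] with q h1 h2
    rw [RCLike.inner_apply', h1, h2]
    rfl
  have hint' : Integrable (fun q : (Config n × Config n) × (Space × Space) =>
      conj (Ψ (Matrix.vecCons q.2.2 q.1.1) * Ψ (Matrix.vecCons q.2.1 q.1.2)) *
        (Ψ (Matrix.vecCons q.2.1 q.1.1) * Ψ (Matrix.vecCons q.2.2 q.1.2))) volume := by
    refine hint.congr (Filter.Eventually.of_forall fun q => ?_)
    simp only [hΦF]
    rfl
  have hswap := integral_twoCopy_swap_eq_swapPurity hΨ hint'
  have hre : RCLike.re (∫ q, conj (Φ (F q)) * Φ q) = (swapPurity n Ψ).toReal := by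
    have h' : ∫ q, conj (Φ (F q)) * Φ q = ((swapPurity n Ψ).toReal : ℂ) := by
      rw [← hswap]
      refine integral_congr_ae (Filter.Eventually.of_forall fun q => ?_)
      simp only [hΦF]
      rfl
    rw [h', RCLike.re_to_complex, Complex.ofReal_re]
  rw [hre] at hH
  exact hH

/-- **The midpoint inequality on the two-copy cell of the torus.** Let
`Ψ : (ℝ³)^{n+1} → ℂ` be measurable and normalised on `cell^{n+1}`, and let
`Θ : (ℝ³)^{n+1} × (ℝ³)^{n+1} → ℂ` be measurable, normalised on the two-copy cell
`C₂ = cell^{n+1} × cell^{n+1}` and symmetric under the one-pair swap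
`F : (X, Y) ↦ (y₀ :: X̂, x₀ :: Ŷ)`. Then
`2 |∫_{C₂} conj Θ · (Ψ ⊗ Ψ)|² - 1 ≤ swapPurity n (1_{cell^{n+1}} Ψ)`, i.e.
`⟨Φ, UΦ⟩ ≥ 2|⟨Θ, Φ⟩|² - 1` for `Φ = 1_{C₂} Ψ ⊗ Ψ`, `U = (· ∘ F)` on `L²(C₂)` together with
`⟨Φ, UΦ⟩ = tr(γ²)/N²` (`two_mul_sq_sub_one_le_swapPurity` transported along the glue coordinates,
the truncations being indicators). [cite: PenroseOnsager1956, §4 (5)–(6)] -/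
theorem two_mul_sq_sub_one_le_swapPurity_indicator {L : ℝ} {Ψ : Config (n + 1) → ℂ}
    (hΨ : Measurable Ψ) (hΨ1 : ∫⁻ X in cellN (n + 1) L, (‖Ψ X‖₊ : ℝ≥0∞) ^ 2 = 1)
    {Θ : Config (n + 1) × Config (n + 1) → ℂ} (hΘ : Measurable Θ)
    (hΘF : ∀ X Y : Config (n + 1),
      Θ (Matrix.vecCons (Y 0) (Fin.tail X), Matrix.vecCons (X 0) (Fin.tail Y)) = Θ (X, Y))
    (hΘ1 : ∫⁻ Z in cellN (n + 1) L ×ˢ cellN (n + 1) L, (‖Θ Z‖₊ : ℝ≥0∞) ^ 2 = 1) :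
    2 * ‖∫ Z in cellN (n + 1) L ×ˢ cellN (n + 1) L,
        conj (Θ Z) * (Ψ Z.1 * Ψ Z.2)‖ ^ 2 - 1 ≤
      (swapPurity n ((cellN (n + 1) L).indicator Ψ)).toReal := by
  have hCm : MeasurableSet (cellN (n + 1) L) := measurableSet_cellN _ _
  have hC2m : MeasurableSet (cellN (n + 1) L ×ˢ cellN (n + 1) L) := hCm.prod hCm
  -- truncations
  have hΨcm : Measurable ((cellN (n + 1) L).indicator Ψ) := hΨ.indicator hCm
  have hΘcm : Measurable ((cellN (n + 1) L ×ˢ cellN (n + 1) L).indicator Θ) :=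
    hΘ.indicator hC2m
  have hΨc1 : ∫⁻ X, (‖(cellN (n + 1) L).indicator Ψ X‖₊ : ℝ≥0∞) ^ 2 = 1 := by
    rw [← hΨ1, ← lintegral_indicator hCm]
    refine lintegral_congr fun X => ?_
    by_cases hX : X ∈ cellN (n + 1) L <;> simp [hX]
  -- glue coordinates
  obtain ⟨e, he, hecoe⟩ := exists_measurableEquiv_twoCopy n
  -- the transported `Θ' = (1_{C₂} Θ) ∘ e`: normalised …
  have hΘ'1 : ∫⁻ q, (‖(cellN (n + 1) L ×ˢ cellN (n + 1) L).indicator Θ (e q)‖₊ : ℝ≥0∞) ^ 2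
      = 1 := by
    calc ∫⁻ q, (‖(cellN (n + 1) L ×ˢ cellN (n + 1) L).indicator Θ (e q)‖₊ : ℝ≥0∞) ^ 2
        = ∫⁻ Z, (‖(cellN (n + 1) L ×ˢ cellN (n + 1) L).indicator Θ Z‖₊ : ℝ≥0∞) ^ 2 :=
          he.lintegral_comp (hΘcm.nnnorm.coe_nnreal_ennreal.pow_const 2)
      _ = ∫⁻ Z, (cellN (n + 1) L ×ˢ cellN (n + 1) L).indicator
            (fun Z => (‖Θ Z‖₊ : ℝ≥0∞) ^ 2) Z := by
          refine lintegral_congr fun Z => ?_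
          by_cases hZ : Z ∈ cellN (n + 1) L ×ˢ cellN (n + 1) L <;> simp [hZ]
      _ = 1 := by rw [lintegral_indicator hC2m, hΘ1]
  -- … and swap-symmetric
  have hΘ'F : ∀ q : (Config n × Config n) × (Space × Space),
      (cellN (n + 1) L ×ˢ cellN (n + 1) L).indicator Θ (e (Prod.map id Prod.swap q)) =
        (cellN (n + 1) L ×ˢ cellN (n + 1) L).indicator Θ (e q) := by
    rintro ⟨⟨X, Y⟩, ⟨x, y⟩⟩
    rw [hecoe, hecoe]
    simp only [Prod.map_apply, id_eq, Prod.swap_prod_mk]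
    have key := hΘF (Matrix.vecCons x X) (Matrix.vecCons y Y)
    simp only [Matrix.cons_val_zero, tail_vecCons] at key
    by_cases h : (Matrix.vecCons x X, Matrix.vecCons y Y) ∈ cellN (n + 1) L ×ˢ cellN (n + 1) L
    · have h' : (Matrix.vecCons y X, Matrix.vecCons x Y) ∈ cellN (n + 1) L ×ˢ cellN (n + 1) L := by
        rw [Set.mem_prod, vecCons_mem_cellN_iff, vecCons_mem_cellN_iff] at h
        rw [Set.mem_prod, vecCons_mem_cellN_iff, vecCons_mem_cellN_iff]
        exact ⟨⟨h.2.1, h.1.2⟩, ⟨h.1.1, h.2.2⟩⟩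
      rw [Set.indicator_of_mem h', Set.indicator_of_mem h, key]
    · have h' : (Matrix.vecCons y X, Matrix.vecCons x Y) ∉ cellN (n + 1) L ×ˢ cellN (n + 1) L := by
        intro h'
        apply h
        rw [Set.mem_prod, vecCons_mem_cellN_iff, vecCons_mem_cellN_iff] at h'
        rw [Set.mem_prod, vecCons_mem_cellN_iff, vecCons_mem_cellN_iff]
        exact ⟨⟨h'.2.1, h'.1.2⟩, ⟨h'.1.1, h'.2.2⟩⟩
      rw [Set.indicator_of_notMem h', Set.indicator_of_notMem h]
  -- the midpoint inequality in glue coordinates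
  have hmid := two_mul_sq_sub_one_le_swapPurity hΨcm hΨc1
    (Θ := fun q => (cellN (n + 1) L ×ˢ cellN (n + 1) L).indicator Θ (e q))
    (hΘcm.comp e.measurable) hΘ'1 hΘ'F
  -- transport the overlap integral back to the two-copy cell
  have hov : ∫ q : (Config n × Config n) × (Space × Space),
      conj ((cellN (n + 1) L ×ˢ cellN (n + 1) L).indicator Θ (e q)) *
        ((cellN (n + 1) L).indicator Ψ (Matrix.vecCons q.2.1 q.1.1) *
          (cellN (n + 1) L).indicator Ψ (Matrix.vecCons q.2.2 q.1.2)) =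
      ∫ Z in cellN (n + 1) L ×ˢ cellN (n + 1) L, conj (Θ Z) * (Ψ Z.1 * Ψ Z.2) := by
    calc ∫ q : (Config n × Config n) × (Space × Space),
          conj ((cellN (n + 1) L ×ˢ cellN (n + 1) L).indicator Θ (e q)) *
            ((cellN (n + 1) L).indicator Ψ (Matrix.vecCons q.2.1 q.1.1) *
              (cellN (n + 1) L).indicator Ψ (Matrix.vecCons q.2.2 q.1.2))
        = ∫ q, (fun Z : Config (n + 1) × Config (n + 1) =>
            conj ((cellN (n + 1) L ×ˢ cellN (n + 1) L).indicator Θ Z) *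
              ((cellN (n + 1) L).indicator Ψ Z.1 * (cellN (n + 1) L).indicator Ψ Z.2)) (e q) := by
          refine integral_congr_ae (Filter.Eventually.of_forall fun q => ?_)
          simp only [hecoe]
      _ = ∫ Z : Config (n + 1) × Config (n + 1),
            conj ((cellN (n + 1) L ×ˢ cellN (n + 1) L).indicator Θ Z) *
              ((cellN (n + 1) L).indicator Ψ Z.1 * (cellN (n + 1) L).indicator Ψ Z.2) :=
          he.integral_comp' (fun Z : Config (n + 1) × Config (n + 1) =>
            conj ((cellN (n + 1) L ×ˢ cellN (n + 1) L).indicator Θ Z) *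
              ((cellN (n + 1) L).indicator Ψ Z.1 * (cellN (n + 1) L).indicator Ψ Z.2))
      _ = ∫ Z : Config (n + 1) × Config (n + 1), (cellN (n + 1) L ×ˢ cellN (n + 1) L).indicator
            (fun Z => conj (Θ Z) * (Ψ Z.1 * Ψ Z.2)) Z := by
          refine integral_congr_ae (Filter.Eventually.of_forall fun Z => ?_)
          by_cases hZ : Z ∈ cellN (n + 1) L ×ˢ cellN (n + 1) L
          · have h12 : Z.1 ∈ cellN (n + 1) L ∧ Z.2 ∈ cellN (n + 1) L := hZ
            simp [Set.indicator_of_mem, hZ, h12.1, h12.2]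
          · simp [Set.indicator_of_notMem, hZ]
      _ = ∫ Z in cellN (n + 1) L ×ˢ cellN (n + 1) L, conj (Θ Z) * (Ψ Z.1 * Ψ Z.2) :=
          integral_indicator hC2m
  rw [hov] at hmid
  exact hmid

end Midpoint

/-- **The normalised constant is admissible for the two-copy torus problem.** For `L > 0` the
constant `|C₂|^{-1/2}` on `(ℝ³)^{n+1} × (ℝ³)^{n+1}` (`C₂ = cell^{n+1} × cell^{n+1}`,
`|C₂| = L^{6(n+1)} ∈ (0, ∞)`) is `C¹`, `Lℤ³`-periodic in every coordinate of both copies,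
symmetric under the one-pair swap `F : (X, Y) ↦ (y₀ :: X̂, x₀ :: Ŷ)`, and normalised on `C₂` —
the four clauses of the admissible class `Adm` of `TorusHalfSwapOverlap`, verbatim. [folklore] -/
theorem exists_adm_const {n : ℕ} {L : ℝ} (hL : 0 < L) :
    ∃ Θ₀ : Config (n + 1) × Config (n + 1) → ℂ,
      ContDiff ℝ 1 Θ₀ ∧
      (∀ (Z : Config (n + 1) × Config (n + 1)) (i : Fin (n + 1)) (k : Fin 3),
        Θ₀ (Z.1 + Pi.single i (EuclideanSpace.single k L), Z.2) = Θ₀ Z ∧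
          Θ₀ (Z.1, Z.2 + Pi.single i (EuclideanSpace.single k L)) = Θ₀ Z) ∧
      (∀ X Y : Config (n + 1),
        Θ₀ (Matrix.vecCons (Y 0) (Fin.tail X), Matrix.vecCons (X 0) (Fin.tail Y)) = Θ₀ (X, Y)) ∧
      ∫⁻ Z in cellN (n + 1) L ×ˢ cellN (n + 1) L, (‖Θ₀ Z‖₊ : ENNReal) ^ 2 = 1 := by
  -- the two-copy cell has finite positive volume `V = (L³)^{n+1} · (L³)^{n+1}`
  set V : ℝ≥0∞ := volume (cellN (n + 1) L ×ˢ cellN (n + 1) L) with hV_def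
  have hV : V = (ENNReal.ofReal L ^ 3) ^ (n + 1) * (ENNReal.ofReal L ^ 3) ^ (n + 1) := by
    rw [hV_def, Measure.volume_eq_prod, Measure.prod_prod, volume_cellN]
  have hL' : ENNReal.ofReal L ≠ 0 := by
    rw [ENNReal.ofReal_ne_zero_iff]
    exact hL
  have hV0 : V ≠ 0 := by
    rw [hV]
    exact mul_ne_zero (pow_ne_zero _ (pow_ne_zero _ hL')) (pow_ne_zero _ (pow_ne_zero _ hL'))
  have hVtop : V ≠ ⊤ := by
    rw [hV]
    exact ENNReal.mul_ne_top (ENNReal.pow_ne_top (ENNReal.pow_ne_top ENNReal.ofReal_ne_top))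
      (ENNReal.pow_ne_top (ENNReal.pow_ne_top ENNReal.ofReal_ne_top))
  -- the normalising constant `c = V^{-1/2}`
  let c : ℝ≥0 := NNReal.sqrt (V.toNNReal)⁻¹
  have hc : (c : ℝ≥0∞) ^ 2 * V = 1 := by
    rw [← ENNReal.coe_pow, NNReal.sq_sqrt,
      ENNReal.coe_inv (ENNReal.toNNReal_ne_zero.2 ⟨hV0, hVtop⟩), ENNReal.coe_toNNReal hVtop,
      ENNReal.inv_mul_cancel hV0 hVtop]
  have hnorm : (‖(c : ℂ)‖₊ : ℝ≥0∞) = c := by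
    rw [show ((c : ℂ)) = ((c : ℝ) : ℂ) from rfl, Complex.nnnorm_real, NNReal.nnnorm_eq]
  refine ⟨fun _ => (c : ℂ), contDiff_const, fun _ _ _ => ⟨rfl, rfl⟩, fun _ _ => rfl, ?_⟩
  rw [setLIntegral_const, hnorm, ← hV_def, hc]

/-- **From the half-swap overlap to the swap bound, for one trial state.** Let `Ψ` be measurable
and normalised on `cell^{n+1}`; let `Adm` be any class of two-copy states that is non-empty and
whose members are measurable, swap-symmetric and normalised on `C₂ = cell^{n+1} × cell^{n+1}`,
and `E2` any `[0, ∞]`-valued functional. If every `δ`-near-minimiser `Θ ∈ Adm` of `E2`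
(`δ > 0`) satisfies `|∫_{C₂} conj Θ · (Ψ ⊗ Ψ)|² ≥ ½ + η`, then
`swapPurity n (1_{cell^{n+1}} Ψ) ≥ 2η`: pick one such `Θ` (`exists_le_iInf₂_add`) and apply the
midpoint inequality `2|⟨Θ, Φ⟩|² - 1 ≤ ⟨Φ, UΦ⟩ = swapPurity`
(`two_mul_sq_sub_one_le_swapPurity_indicator`). [cite: PenroseOnsager1956, §4 (5)–(6)] -/
theorem ofReal_two_mul_le_swapPurity {n : ℕ} {L η : ℝ} {δ : ℝ≥0∞}
    {Ψ : Config (n + 1) → ℂ}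
    {Adm : (Config (n + 1) × Config (n + 1) → ℂ) → Prop}
    {E2 : (Config (n + 1) × Config (n + 1) → ℂ) → ℝ≥0∞}
    (hmain : ∀ Θ : Config (n + 1) × Config (n + 1) → ℂ, Adm Θ →
      E2 Θ ≤ (⨅ (Θ' : Config (n + 1) × Config (n + 1) → ℂ) (_ : Adm Θ'), E2 Θ') + δ →
        ENNReal.ofReal (1 / 2 + η) ≤
          (‖∫ Z in cellN (n + 1) L ×ˢ cellN (n + 1) L,
              (starRingEnd ℂ) (Θ Z) * (Ψ Z.1 * Ψ Z.2)‖₊ : ENNReal) ^ 2)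
    (hδ : 0 < δ) (hΨ : Measurable Ψ)
    (hΨ1 : ∫⁻ X in cellN (n + 1) L, (‖Ψ X‖₊ : ℝ≥0∞) ^ 2 = 1)
    (h0 : ∃ Θ₀, Adm Θ₀)
    (hA : ∀ Θ, Adm Θ → Measurable Θ ∧
      (∀ X Y : Config (n + 1),
        Θ (Matrix.vecCons (Y 0) (Fin.tail X), Matrix.vecCons (X 0) (Fin.tail Y)) = Θ (X, Y)) ∧
      ∫⁻ Z in cellN (n + 1) L ×ˢ cellN (n + 1) L, (‖Θ Z‖₊ : ℝ≥0∞) ^ 2 = 1) :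
    ENNReal.ofReal (2 * η) ≤ swapPurity n ((cellN (n + 1) L).indicator Ψ) := by
  -- an admissible `δ`-near-minimiser of `E2`
  obtain ⟨Θ, hAdm, hE⟩ := exists_le_iInf₂_add E2 h0 hδ
  obtain ⟨hΘm, hΘF, hΘ1⟩ := hA Θ hAdm
  -- its overlap with `Ψ ⊗ Ψ` is at least `½ + η` …
  have hov := hmain Θ hAdm hE
  have hα : 1 / 2 + η ≤ ‖∫ Z in cellN (n + 1) L ×ˢ cellN (n + 1) L,
      (starRingEnd ℂ) (Θ Z) * (Ψ Z.1 * Ψ Z.2)‖ ^ 2 := by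
    have h1 : ((‖∫ Z in cellN (n + 1) L ×ˢ cellN (n + 1) L,
        (starRingEnd ℂ) (Θ Z) * (Ψ Z.1 * Ψ Z.2)‖₊ : ℝ≥0∞)) ^ 2 =
        ENNReal.ofReal (‖∫ Z in cellN (n + 1) L ×ˢ cellN (n + 1) L,
          (starRingEnd ℂ) (Θ Z) * (Ψ Z.1 * Ψ Z.2)‖ ^ 2) := by
      rw [ENNReal.ofReal_pow (norm_nonneg _), ofReal_norm]
      rfl
    rw [h1] at hov
    exact (ENNReal.ofReal_le_ofReal_iff (sq_nonneg _)).1 hov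
  -- … and the midpoint inequality bounds the swap purity by `2|overlap|² - 1 ≥ 2η`
  have hmid := two_mul_sq_sub_one_le_swapPurity_indicator hΨ hΨ1 hΘm hΘF hΘ1
  have h2η : 2 * η ≤ (swapPurity n ((cellN (n + 1) L).indicator Ψ)).toReal := by linarith
  exact (ENNReal.ofReal_le_ofReal h2η).trans ENNReal.ofReal_toReal_le

/-- **`MidpointLemma`: `TorusHalfSwapOverlap → TorusSwapBound`** (item
stmt-AtomisticToContinuum-14396 of route BECSwapNoCatastrophe). With `ρ₀` from the half-swap
overlap bound and, for `0 < ρ < ρ₀`, its `η`, put `c := 2η`; for `n` in the eventual set take its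
`δ`; for a periodic `δ`-near-minimiser `Ψ` pick an `F`-symmetric `δ`-near-minimiser `Θ` of the
two-copy form in `Adm` (non-empty: the normalised constant), get `|⟨Θ, Ψ⊗Ψ⟩|² ≥ ½ + η`, and
conclude by the midpoint inequality `⟨Φ, UΦ⟩ ≥ 2|⟨Θ, Φ⟩|² - 1 ≥ 2η` with
`⟨Φ, UΦ⟩ = swapPurity n (1_{cell^{n+1}} Ψ)`. [cite: PenroseOnsager1956, §4 (5)–(6)] -/
theorem midpointLemma_proof :
    Summit.AtomisticToContinuum.BoseEinsteinCondensation.Theses.BECSwapNoCatastrophe.MidpointLemma := by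
  intro hHalf v hv
  obtain ⟨ρ₀, hρ₀, hρ⟩ := hHalf v hv
  refine ⟨ρ₀, hρ₀, fun ρ hρpos hρlt => ?_⟩
  obtain ⟨η, hη, hev⟩ := hρ ρ hρpos hρlt
  refine ⟨2 * η, by positivity, ?_⟩
  filter_upwards [hev] with n hn
  obtain ⟨δ, hδ, hmain⟩ := hn
  refine ⟨δ, hδ, fun Ψ hΨ => ?_⟩
  have hL : 0 < sideLength ρ (n + 1) := by
    unfold sideLength
    positivity
  obtain ⟨Θ₀, hΘ₀⟩ := exists_adm_const (n := n) hL
  exact ofReal_two_mul_le_swapPurity (hmain Ψ hΨ) hδ Ψ.contDiff.continuous.measurable Ψ.norm_eq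
    ⟨Θ₀, hΘ₀⟩ (fun Θ hΘ => ⟨hΘ.1.continuous.measurable, hΘ.2.2.1, hΘ.2.2.2⟩)

end Summit.AtomisticToContinuum.BoseEinsteinCondensation.Theorems

end
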